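import Summits.ValiantsHypothesis.ValiantsHypothesis.Theorems.FifoMatchingNNDivisionHardLocatedFaceExposure

/-!
# CONE PRICING on the zonotope chapter of COR-VIRTUAL (crux `NNDivisionHard`, stmt-ValiantsHypothesis-21181) — part 1/5 — §2–§8: CLIQUE-CONE SANDWICH; corona kernels pair to increments of `q_W`

Theorems-side port (val-port-1 g3, presser; declaration texts VERBATIM, one-line docstrings added where the gate lint wants them) of val-idea-44
g0's author-staged transplant `FifoMatchingNNDivisionHardConePricing.lean` (sha16 51fc894432d3ede5) of the crux workfile
`Cruxes/NNDivisionHard/ConePricing44.lean` rev 10 @0a2b2fead3a1 (W5-R2; critic of record val-idea-crit-9 g1: WAVE-5 LIST row (6) KEEP §G(3)+(4),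
ADDENDUM A4 SIG-FIRST GO 2026-08-28T22:04:39Z), split by the 400-line cap into five modules: `…ConePricing` (§2–§8) → `…Antitone` (§9–§11, §13)
→ `…Corona` (§12); `…ConePricing` → `…BalancedFaceZones` (§14, zones) → `…BalancedFace` (§14 theorem, §14b).  Statement-free (δ-unfolded `Prop`s).

* §2–§7 CLIQUE-CONE SANDWICH: `sandwich_three_pow_le` (rooted rank-one points inside, `P ⊆ cone{bbᵀ}` ⇒ `3^n ≤ (xc+1)·2^n`, BFPS12 Prop. 3
  pattern via `HasEFOfSize.three_pow_le`); `rootedCliqueCone_three_pow_le`, `zFull_own_three_pow_le`, `shatteringTower_three_pow_le`.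
* §8 `dot_coronaKernel` (`⟨W, P_{A∪B} − P_B⟩ = q_W(A∪B) − q_W(B)`), `qf_insert`, `qf_union_le`, singleton antitonicity
  `antitone_dot_corona_nonpos`.

HONEST LABEL: helper rows for an OPEN crux (21181 `NNDivisionHard` OPEN; COR-VIRTUAL / `CovZonoHard` OPEN); nothing here is a summit
statement; VP ≠ VNP is NOT proved.
-/

set_option autoImplicit false
-- the mandated summit-side namespace repeats a component by design (single-problem summit)
set_option linter.dupNamespace false

noncomputable section
open Matrix Finset
open scoped Pointwise

namespace Summit.ValiantsHypothesis.ValiantsHypothesis.Theorems.FifoMatching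

namespace ConePricing

open Literature.Barriers.PneNP (HasEFOfSize)
open Literature.Combinatorics.Optimization (corPolytopeGraph corVec)

variable {h : ℕ}

/-! ## 2. The clique cone `cone{bbᵀ}` is UDISJ-hard (BFPS12 Prop. 3 pattern, Kaibel–Weltge count) -/

/-- `cone{bbᵀ : b ∈ {0,1}^h}` (the completely-positive-0/1 / clique cone; `b = 0` contributes nothing). -/
def cliqueCone (h : ℕ) : Set (Fin h × Fin h → ℝ) :=
  {x | ∃ μ : (Fin h → Bool) → ℝ, (∀ b, 0 ≤ μ b) ∧ x = ∑ b, μ b • corVec (⊤ : SimpleGraph (Fin h)) b}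

/-- the ROOTED clique cone `cone{(1,b)(1,b)ᵀ : b ∈ {0,1}^n} ⊂ Sym_{n+1}` (root = index `0`). -/
def rootedCliqueCone (n : ℕ) : Set (Fin (n + 1) × Fin (n + 1) → ℝ) :=
  {x | ∃ μ : (Fin n → Bool) → ℝ, (∀ b, 0 ≤ μ b) ∧
    x = ∑ b, μ b • corVec (⊤ : SimpleGraph (Fin (n + 1))) (Fin.cons true b)}

/-- the generators lie in the rooted cone. -/
theorem corVec_cons_mem_rootedCliqueCone (n : ℕ) (b : Fin n → Bool) :
    corVec (⊤ : SimpleGraph (Fin (n + 1))) (Fin.cons true b) ∈ rootedCliqueCone n := by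
  classical
  refine ⟨fun b' => if b' = b then 1 else 0, fun b' => by simp only; split_ifs <;> norm_num, ?_⟩
  simp [ite_smul, Finset.sum_ite_eq']

/-! ## 3. Corollary: `Z_full` is not budgeted (unconditionally) -/

/-- `Z_full(h) = Σ_{b ∈ {0,1}^h} [0,1]·bbᵀ` (the zone `b = 0` is the zero vector and harmless). -/
def zFull (h : ℕ) : Set (Fin h × Fin h → ℝ) :=
  {x | ∃ μ : (Fin h → Bool) → ℝ, (∀ b, 0 ≤ μ b ∧ μ b ≤ 1) ∧ x = ∑ b, μ b • corVec (⊤ : SimpleGraph (Fin h)) b}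

/-- `0 ∈ Z_full`. -/
theorem zero_mem_zFull (h : ℕ) : (0 : Fin h × Fin h → ℝ) ∈ zFull h :=
  ⟨fun _ => 0, fun _ => by norm_num, by simp⟩

/-! ## 4. The wall: corona-covering zonotopes are apex-cheap -/

/-- indicator vector of a finset as a Boolean string. -/
def ind (A : Finset (Fin h)) : Fin h → Bool := fun p => decide (p ∈ A)

/-- the corona kernel `g_{A,B} = P_{A∪B} − P_B` (val-idea-41 rev 1.7 (E4.1)/(E4.5)): `1` on `A×A ∪ A×B ∪ B×A`, `0` elsewhere. -/
def coronaKernel (A B : Finset (Fin h)) : Fin h × Fin h → ℝ :=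
  corVec (⊤ : SimpleGraph (Fin h)) (ind (A ∪ B)) - corVec (⊤ : SimpleGraph (Fin h)) (ind B)

/-- the (unconstrained) corona cone `cone{g_{A,B} : A ≠ ∅, A ∩ B = ∅}` — the apex cone (direction `−I`) of
`Z'_cor = Σ_{(A,B)} [0,1]·g_{A,B}`; the size-matched `Z_cor` of (E4.5) has the same cone after projection to any block of size `< h/2`. -/
def coronaCone (h : ℕ) : Set (Fin h × Fin h → ℝ) :=
  {x | ∃ μ : Finset (Fin h) × Finset (Fin h) → ℝ, (∀ AB, 0 ≤ μ AB) ∧ (∀ AB, (AB.1 = ∅ ∨ ¬ Disjoint AB.1 AB.2) → μ AB = 0) ∧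
    x = ∑ AB, μ AB • coronaKernel AB.1 AB.2}

/-- the ANTITONE cone: symmetric `W` whose pseudo-Boolean quadratic `S ↦ 𝟙_Sᵀ W 𝟙_S` is non-increasing, in its singleton form
`W_xx + 2·Σ_{t ∈ T} W_xt ≤ 0` for all `x ∉ T` (these imply `q_W(S ∪ T) ≤ q_W(T)` for all disjoint `S, T` by telescoping). -/
def antitoneCone (h : ℕ) : Set (Fin h × Fin h → ℝ) :=
  {W | (∀ p q, W (p, q) = W (q, p)) ∧ ∀ (x : Fin h) (T : Finset (Fin h)), x ∉ T → W (x, x) + 2 * ∑ t ∈ T, W (x, t) ≤ 0}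




/-! ## 5. PROOF of `RootedCliqueConeHard` (kernel food: the clique cone carries the UDISJ pattern) -/

/-- indicator of a Boolean string as a real. -/
def chi {m : ℕ} (b : Fin m → Bool) (p : Fin m) : ℝ := if b p then 1 else 0

/-- on the complete graph, `corVec b` is the rank-one 0/1 matrix `𝟙_b 𝟙_bᵀ`. -/
theorem corVec_top_apply {m : ℕ} (b : Fin m → Bool) (p q : Fin m) :
    corVec (⊤ : SimpleGraph (Fin m)) b (p, q) = chi b p * chi b q := by
  unfold corVec chi
  by_cases hpq : p = q
  · subst hpq; cases b p <;> simp
  · simp only [hpq, SimpleGraph.top_adj, ne_eq, not_false_eq_true, if_true, if_false]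
    cases b p <;> cases b q <;> simp

/-- a rank-one functional `X ↦ Σ_{p,q} w_p w_q X_{pq}` evaluates on `𝟙_b𝟙_bᵀ` to the square `(w·𝟙_b)²`. -/
theorem rankOne_dot_corVec {m : ℕ} (w : Fin m → ℝ) (b : Fin m → Bool) :
    (fun x : Fin m × Fin m => w x.1 * w x.2) ⬝ᵥ corVec (⊤ : SimpleGraph (Fin m)) b
      = (∑ p, w p * chi b p) ^ 2 := by
  simp only [dotProduct, Fintype.sum_prod_type, corVec_top_apply]
  rw [sq, Finset.sum_mul_sum]
  exact Finset.sum_congr rfl fun p _ => Finset.sum_congr rfl fun q _ => by ring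

/-- the BFPS vector `u_a = (−1, 𝟙_a)`. -/
def uVec {n : ℕ} (a : Finset (Fin n)) : Fin (n + 1) → ℝ :=
  Fin.cons (-1) fun i => if i ∈ a then 1 else 0

/-- the inequality normals `c_a = −u_a u_aᵀ` (so `c_a · X ≤ 0` reads `⟨u_a u_aᵀ, X⟩ ≥ 0`). -/
def cIneq {n : ℕ} (a : Finset (Fin n)) : Fin (n + 1) × Fin (n + 1) → ℝ :=
  fun x => -(uVec a x.1 * uVec a x.2)

/-- the points `v_b = (1, 𝟙_b)(1, 𝟙_b)ᵀ`. -/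
def vPt {n : ℕ} (b : Finset (Fin n)) : Fin (n + 1) × Fin (n + 1) → ℝ :=
  corVec (⊤ : SimpleGraph (Fin (n + 1))) (Fin.cons true fun i => decide (i ∈ b))

/-- the BFPS functional `cIneq a` pairs with a rooted clique correlation vertex to minus a square. -/
theorem cIneq_dot_corVec {n : ℕ} (a : Finset (Fin n)) (b : Fin n → Bool) :
    cIneq a ⬝ᵥ corVec (⊤ : SimpleGraph (Fin (n + 1))) (Fin.cons true b)
      = -((∑ p, uVec a p * chi (Fin.cons true b : Fin (n + 1) → Bool) p) ^ 2) := by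
  rw [show cIneq a = -(fun x : Fin (n + 1) × Fin (n + 1) => uVec a x.1 * uVec a x.2) from rfl,
    neg_dotProduct, rankOne_dot_corVec]

/-- `∑_p u_a(p)·χ_b(p) = |a ∩ b| − 1` for the rooted indicator of `b`. -/
theorem sum_uVec_chi {n : ℕ} (a b : Finset (Fin n)) :
    ∑ p, uVec a p * chi (Fin.cons true (fun i => decide (i ∈ b)) : Fin (n + 1) → Bool) p
      = ((a ∩ b).card : ℝ) - 1 := by
  rw [Fin.sum_univ_succ]
  have h0 : uVec a 0 * chi (Fin.cons true (fun i => decide (i ∈ b)) : Fin (n + 1) → Bool) 0 = -1 := by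
    simp [uVec, chi]
  have hs : ∀ i : Fin n, uVec a i.succ * chi (Fin.cons true (fun i => decide (i ∈ b)) : Fin (n + 1) → Bool) i.succ
      = if i ∈ a ∩ b then 1 else 0 := by
    intro i
    by_cases ha : i ∈ a <;> by_cases hb : i ∈ b <;> simp [uVec, chi, ha, hb]
  rw [h0, Finset.sum_congr rfl fun i _ => hs i, Finset.sum_boole]
  have hf : Finset.univ.filter (fun i => i ∈ a ∩ b) = a ∩ b := by ext i; simp
  rw [hf]
  ring

/-- `⟨cIneq a, vPt b⟩ = −(|a ∩ b| − 1)²`. -/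
theorem cIneq_dot_vPt {n : ℕ} (a b : Finset (Fin n)) :
    cIneq a ⬝ᵥ vPt b = -((((a ∩ b).card : ℝ) - 1) ^ 2) := by
  rw [vPt, cIneq_dot_corVec, sum_uVec_chi]

/-- ★ PROVED: the rooted clique cone `cone{(1,b)(1,b)ᵀ}` has no extended formulation of size `r` with `(r+1)·2^n < 3^n`. -/
theorem rootedCliqueCone_three_pow_le (n r : ℕ) (hEF : HasEFOfSize (rootedCliqueCone n) r) :
    3 ^ n ≤ (r + 1) * 2 ^ n := by
  classical
  refine hEF.three_pow_le vPt (fun b => corVec_cons_mem_rootedCliqueCone n _) cIneq (fun _ => 0) ?_ ?_ ?_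
  · rintro a x ⟨μ, hμ, rfl⟩
    rw [dotProduct_sum]
    refine Finset.sum_nonpos fun b _ => ?_
    rw [dotProduct_smul, smul_eq_mul, cIneq_dot_corVec]
    exact mul_nonpos_of_nonneg_of_nonpos (hμ b) (neg_nonpos.mpr (sq_nonneg _))
  · intro a b hlt hcard
    rw [cIneq_dot_vPt, hcard] at hlt
    norm_num at hlt
  · intro a b hab
    rw [cIneq_dot_vPt, Finset.disjoint_iff_inter_eq_empty.mp hab]
    norm_num


/-! ## 6. PROOF that `Z_full` is not budgeted — directly: `Z_full` is SANDWICHED between the rooted rank-one points and the clique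
cone, and the BFPS inequalities are homogeneous, so the UDISJ pattern survives on `Z_full` itself (no tangent cone needed in the kernel). -/

/-- unrooted form of `cIneq_dot_corVec`: `⟨cIneq a, corVec ⊤ b⟩ = −(∑_p u_a(p)·χ_b(p))²`. -/
theorem cIneq_dot_corVec' {n : ℕ} (a : Finset (Fin n)) (b : Fin (n + 1) → Bool) :
    cIneq a ⬝ᵥ corVec (⊤ : SimpleGraph (Fin (n + 1))) b = -((∑ p, uVec a p * chi b p) ^ 2) := by
  rw [show cIneq a = -(fun x : Fin (n + 1) × Fin (n + 1) => uVec a x.1 * uVec a x.2) from rfl,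
    neg_dotProduct, rankOne_dot_corVec]

/-- the BFPS functionals are nonpositive on the whole clique cone. -/
theorem cIneq_dot_nonpos_of_mem_cliqueCone {n : ℕ} (a : Finset (Fin n)) {x : Fin (n + 1) × Fin (n + 1) → ℝ}
    (hx : x ∈ cliqueCone (n + 1)) : cIneq a ⬝ᵥ x ≤ 0 := by
  classical
  obtain ⟨μ, hμ, rfl⟩ := hx
  rw [dotProduct_sum]
  refine Finset.sum_nonpos fun b _ => ?_
  rw [dotProduct_smul, smul_eq_mul, cIneq_dot_corVec']
  exact mul_nonpos_of_nonneg_of_nonpos (hμ b) (neg_nonpos.mpr (sq_nonneg _))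

/-- ★ CLIQUE-CONE SANDWICH (PROVED): any set containing the rooted rank-one points `(1,𝟙_b)(1,𝟙_b)ᵀ` and contained in the clique cone
`cone{bbᵀ}` has no EF of size `r` with `(r+1)·2^n < 3^n` — i.e. `xc ≥ 1.5^n − 1`. -/
theorem sandwich_three_pow_le {n r : ℕ} {P : Set (Fin (n + 1) × Fin (n + 1) → ℝ)}
    (hpts : ∀ b : Finset (Fin n), vPt b ∈ P) (hsub : P ⊆ cliqueCone (n + 1)) (hP : HasEFOfSize P r) :
    3 ^ n ≤ (r + 1) * 2 ^ n := by
  classical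
  refine hP.three_pow_le vPt hpts cIneq (fun _ => 0) ?_ ?_ ?_
  · intro a x hx
    exact cIneq_dot_nonpos_of_mem_cliqueCone a (hsub hx)
  · intro a b hlt hcard
    rw [cIneq_dot_vPt, hcard] at hlt
    norm_num at hlt
  · intro a b hab
    rw [cIneq_dot_vPt, Finset.disjoint_iff_inter_eq_empty.mp hab]
    norm_num

/-- the rooted rank-one point `vPt b` lies in `Z_full`. -/
theorem vPt_mem_zFull {n : ℕ} (b : Finset (Fin n)) : vPt b ∈ zFull (n + 1) := by
  classical
  refine ⟨fun b' => if b' = (Fin.cons true fun i => decide (i ∈ b)) then 1 else 0,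
    fun b' => by simp only; split_ifs <;> norm_num, ?_⟩
  simp [vPt, ite_smul, Finset.sum_ite_eq']

/-- `Z_full ⊆ cone{bbᵀ}`. -/
theorem zFull_subset_cliqueCone (h : ℕ) : zFull h ⊆ cliqueCone h := by
  rintro x ⟨μ, hμ, rfl⟩
  exact ⟨μ, fun b => (hμ b).1, rfl⟩

/-- ★ PROVED, sharper than `ZFullUnbudgeted`: `xc(Z_full(n+1)) = r ⇒ 3^n ≤ (r+1)·2^n`. `Z_full` is NOT a budgeted passenger. -/
theorem zFull_own_three_pow_le (n r : ℕ) (hP : HasEFOfSize (zFull (n + 1)) r) : 3 ^ n ≤ (r + 1) * 2 ^ n :=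
  sandwich_three_pow_le vPt_mem_zFull (zFull_subset_cliqueCone (n + 1)) hP


/-! ## 7. PROOF of `ShatteringTowerUnbudgeted` (C2): the same sandwich on a shattered block — points = (scaled) zones whose pattern on
the block is rooted, inequalities = BFPS functionals pushed forward along the block embedding. -/

/-- a negative rank-one functional `−w wᵀ` pairs with a clique correlation vertex to `−(∑_p w_p·χ_b(p))²`. -/
theorem negRankOne_dot_corVec {m : ℕ} (w : Fin m → ℝ) (b : Fin m → Bool) :
    (fun x : Fin m × Fin m => -(w x.1 * w x.2)) ⬝ᵥ corVec (⊤ : SimpleGraph (Fin m)) b = -((∑ p, w p * chi b p) ^ 2) := by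
  rw [show (fun x : Fin m × Fin m => -(w x.1 * w x.2)) = -(fun x : Fin m × Fin m => w x.1 * w x.2) from rfl,
    neg_dotProduct, rankOne_dot_corVec]

/-- the BFPS vector `u_a` pushed forward along a block embedding `ρ` (zero off the block). -/
def uPush {h d : ℕ} (ρ : Fin (d + 1) ↪ Fin h) (a : Finset (Fin d)) : Fin h → ℝ :=
  fun p => ∑ i, if ρ i = p then uVec a i else 0

/-- pairing the pushed-forward vector `uPush ρ a` with `χ_b` pulls back along the embedding `ρ`. -/
theorem sum_uPush_chi {h d : ℕ} (ρ : Fin (d + 1) ↪ Fin h) (a : Finset (Fin d)) (b : Fin h → Bool) :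
    ∑ p, uPush ρ a p * chi b p = ∑ i, uVec a i * chi b (ρ i) := by
  simp only [uPush, Finset.sum_mul]
  rw [Finset.sum_comm]
  refine Finset.sum_congr rfl fun i _ => ?_
  simp [ite_mul]

/-- ★ SHATTERING TOWERS ARE NOT BUDGETED: any tower `Σ_{b ∈ 𝓑} [0,1]·λ_b bbᵀ`, `λ > 0`, whose index family SHATTERS the block `ρ`
obeys `3^d ≤ (r+2)·2^d` (in fact `r+1`). -/
theorem shatteringTower_three_pow_le (h d r : ℕ) (𝓑 : Finset (Fin h → Bool)) (lam : (Fin h → Bool) → ℝ) (ρ : Fin (d + 1) ↪ Fin h)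
    (hlam : ∀ b ∈ 𝓑, 0 < lam b) (hsh : ∀ s : Fin (d + 1) → Bool, ∃ b ∈ 𝓑, ∀ i, b (ρ i) = s i)
    (hEF : HasEFOfSize {x | ∃ μ : (Fin h → Bool) → ℝ, (∀ b, 0 ≤ μ b ∧ μ b ≤ 1) ∧ (∀ b ∉ 𝓑, μ b = 0) ∧
        x = ∑ b, (μ b * lam b) • corVec (⊤ : SimpleGraph (Fin h)) b} r) :
    3 ^ d ≤ (r + 2) * 2 ^ d := by
  classical
  choose bsel hbmem hbpat using fun a : Finset (Fin d) => hsh (Fin.cons true fun i => decide (i ∈ a))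
  -- the slack computation at the selected zones
  have hslack : ∀ a a' : Finset (Fin d),
      (fun x : Fin h × Fin h => -(uPush ρ a x.1 * uPush ρ a x.2)) ⬝ᵥ
          (lam (bsel a') • corVec (⊤ : SimpleGraph (Fin h)) (bsel a'))
        = lam (bsel a') * -((((a ∩ a').card : ℝ) - 1) ^ 2) := by
    intro a a'
    rw [dotProduct_smul, smul_eq_mul, negRankOne_dot_corVec, sum_uPush_chi]
    have : ∑ i, uVec a i * chi (bsel a') (ρ i)
        = ∑ i, uVec a i * chi (Fin.cons true (fun j => decide (j ∈ a')) : Fin (d + 1) → Bool) i :=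
      Finset.sum_congr rfl fun i _ => by simp only [chi, hbpat a' i]
    rw [this, sum_uVec_chi]
  have key : 3 ^ d ≤ (r + 1) * 2 ^ d := by
    refine hEF.three_pow_le (fun a => lam (bsel a) • corVec (⊤ : SimpleGraph (Fin h)) (bsel a)) ?_
      (fun a x => -(uPush ρ a x.1 * uPush ρ a x.2)) (fun _ => 0) ?_ ?_ ?_
    · -- the selected (scaled) zones lie in the tower
      intro a
      refine ⟨fun b => if b = bsel a then 1 else 0, fun b => by simp only; split_ifs <;> norm_num,
        fun b hb => ?_, ?_⟩
      · simp only
        rw [if_neg]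
        rintro rfl
        exact hb (hbmem a)
      · simp [ite_mul, ite_smul, Finset.sum_ite_eq']
    · -- validity: the functionals are nonpositive on every point of the tower
      rintro a x ⟨μ, hμ, hμoff, rfl⟩
      rw [dotProduct_sum]
      refine Finset.sum_nonpos fun b _ => ?_
      rw [dotProduct_smul, smul_eq_mul, negRankOne_dot_corVec]
      have hcoef : 0 ≤ μ b * lam b := by
        by_cases hb : b ∈ 𝓑
        · exact mul_nonneg (hμ b).1 (hlam b hb).le
        · rw [hμoff b hb]; simp
      exact mul_nonpos_of_nonneg_of_nonpos hcoef (neg_nonpos.mpr (sq_nonneg _))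
    · intro a a' hlt hcard
      rw [hslack, hcard] at hlt
      norm_num at hlt
    · intro a a' hab
      rw [hslack, Finset.disjoint_iff_inter_eq_empty.mp hab]
      have := hlam _ (hbmem a')
      norm_num
      linarith
  exact key.trans (Nat.mul_le_mul_right _ (Nat.le_succ _))


/-! ## 8. (C3) in kernel, easy half: corona kernels pair with `W` to increments of `q_W`; singleton antitonicity telescopes;
hence every antitone `W` is nonpositive on the whole corona cone (the apex chamber of `Z_cor` CONTAINS the antitone cone). -/

/-- the pseudo-Boolean quadratic `q_W(S) = Σ_{x,y ∈ S} W_{xy}`. -/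
def qf (W : Fin h × Fin h → ℝ) (S : Finset (Fin h)) : ℝ := ∑ x ∈ S, ∑ y ∈ S, W (x, y)

/-- `χ_{ind S}(x) = [x ∈ S]`. -/
theorem chi_ind (S : Finset (Fin h)) (x : Fin h) : chi (ind S) x = if x ∈ S then 1 else 0 := by
  simp [chi, ind]

/-- `⟨W, 𝟙_S𝟙_Sᵀ⟩ = q_W(S)`. -/
theorem dot_corVec_ind (W : Fin h × Fin h → ℝ) (S : Finset (Fin h)) :
    W ⬝ᵥ corVec (⊤ : SimpleGraph (Fin h)) (ind S) = qf W S := by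
  classical
  simp only [dotProduct, Fintype.sum_prod_type, corVec_top_apply, chi_ind, qf]
  have inner : ∀ x, ∑ y, W (x, y) * ((if x ∈ S then (1:ℝ) else 0) * (if y ∈ S then 1 else 0))
      = if x ∈ S then ∑ y ∈ S, W (x, y) else 0 := by
    intro x
    by_cases hx : x ∈ S
    · have : ∀ y, W (x, y) * ((if x ∈ S then (1:ℝ) else 0) * (if y ∈ S then 1 else 0)) = if y ∈ S then W (x, y) else 0 := by
        intro y; by_cases hy : y ∈ S <;> simp [hx, hy]
      rw [Finset.sum_congr rfl fun y _ => this y, Finset.sum_ite_mem, Finset.univ_inter, if_pos hx]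
    · have : ∀ y, W (x, y) * ((if x ∈ S then (1:ℝ) else 0) * (if y ∈ S then 1 else 0)) = 0 := by
        intro y; simp [hx]
      rw [Finset.sum_congr rfl fun y _ => this y, Finset.sum_const_zero, if_neg hx]
  rw [Finset.sum_congr rfl fun x _ => inner x, Finset.sum_ite_mem, Finset.univ_inter]

/-- `⟨W, g_{A,B}⟩ = q_W(A ∪ B) − q_W(B)`. -/
theorem dot_coronaKernel (W : Fin h × Fin h → ℝ) (A B : Finset (Fin h)) :
    W ⬝ᵥ coronaKernel A B = qf W (A ∪ B) - qf W B := by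
  rw [coronaKernel, dotProduct_sub, dot_corVec_ind, dot_corVec_ind]

/-- one antitone step: for symmetric `W`, `q_W(T + x) = q_W(T) + W_xx + 2·Σ_{t∈T} W_xt`. -/
theorem qf_insert (W : Fin h × Fin h → ℝ) (hW : ∀ p q, W (p, q) = W (q, p)) {x : Fin h} {T : Finset (Fin h)}
    (hx : x ∉ T) : qf W (insert x T) = qf W T + (W (x, x) + 2 * ∑ t ∈ T, W (x, t)) := by
  classical
  unfold qf
  rw [Finset.sum_insert hx, Finset.sum_insert hx]
  have : ∑ a ∈ T, ∑ b ∈ insert x T, W (a, b) = ∑ a ∈ T, (W (a, x) + ∑ b ∈ T, W (a, b)) :=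
    Finset.sum_congr rfl fun a _ => Finset.sum_insert hx
  rw [this, Finset.sum_add_distrib]
  have hsym : ∑ a ∈ T, W (a, x) = ∑ t ∈ T, W (x, t) := Finset.sum_congr rfl fun t _ => hW t x
  rw [hsym]
  ring

/-- singleton antitonicity telescopes: `q_W(S ∪ T) ≤ q_W(T)` for disjoint `S, T`. -/
theorem qf_union_le (W : Fin h × Fin h → ℝ) (hW : W ∈ antitoneCone h) (S T : Finset (Fin h))
    (hST : Disjoint S T) : qf W (S ∪ T) ≤ qf W T := by
  classical
  induction S using Finset.induction_on with
  | empty => simp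
  | @insert x S' hxS ih =>
    have hxT : x ∉ T := Finset.disjoint_left.mp hST (Finset.mem_insert_self x S')
    have hS'T : Disjoint S' T := Disjoint.mono_left (Finset.subset_insert x S') hST
    have hx : x ∉ S' ∪ T := by simp [hxS, hxT]
    rw [Finset.insert_union, qf_insert W hW.1 hx]
    have hstep := hW.2 x (S' ∪ T) hx
    linarith [ih hS'T]

/-- ★ PROVED (easy half of `CoronaConePolarAntitone`): every antitone `W` is nonpositive on the corona cone —
the normal cone of `Z'_cor` at its apex contains the (cheap) antitone cone. -/
theorem antitone_dot_corona_nonpos {W x : Fin h × Fin h → ℝ} (hW : W ∈ antitoneCone h) (hx : x ∈ coronaCone h) :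
    W ⬝ᵥ x ≤ 0 := by
  classical
  obtain ⟨μ, hμ, hμ0, rfl⟩ := hx
  rw [dotProduct_sum]
  refine Finset.sum_nonpos fun AB _ => ?_
  rw [dotProduct_smul, smul_eq_mul, dot_coronaKernel]
  by_cases hd : Disjoint AB.1 AB.2
  · exact mul_nonpos_of_nonneg_of_nonpos (hμ AB) (sub_nonpos.mpr (qf_union_le W hW _ _ hd))
  · rw [hμ0 AB (Or.inr hd)]; simp

end ConePricing

end Summit.ValiantsHypothesis.ValiantsHypothesis.Theorems.FifoMatching

end
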